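import Mathlib
import Summits.ValiantsHypothesis.ValiantsHypothesis.Theorems.MonotoneRestorationOrbitRestorationQPLevelAction
import Summits.ValiantsHypothesis.ValiantsHypothesis.Theorems.MonotoneRestorationOrbitRestorationQPStableForms
import HarnessLib

/-!
# Structure of symmetric `ΣΠΣ(k)` circuits, I: the non-linear parts of the cluster sums are polynomials in `U = Σ x_pq` (ORBIT currency)

Route MonotoneRestoration, crux `OrbitRestorationQP` (stmt-ValiantsHypothesis-18293), line `depth-three-rung`, registered stub
`stub_sigmaPiSigmaKValue` (A_k).  Namespace `Summit.ValiantsHypothesis.ValiantsHypothesis.Theorems.LevelStructure`.  Route-independent.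

Layer L5 (b) of the formalisation plan of `Cruxes/OrbitRestorationQP/Lines/depth-three-rung-stubA-bounded-fanin.md` (§2 (c)–(e)), at
ONE level `n`, for a matrix-symmetric `f` (invariant under independent row and column permutations, the action `mact σ τ`) with a
clean minimal representation `R` (`…LevelRep.lean`) and a good labelling `cl` of its terms:

(continuing `…LevelAction.lean`: the matrix action `mact`, the `Setting`, `perm_clusterSum`, `rowFix_clusterSum`, `colFix_clusterSum`)
* `nlPart_mem_adjoin_Λ` — the non-linear part of `F_a` lies in `ℂ[Λ_a]`, `Λ_a` = span of `1` and the gcd-free factors of the cluster,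
  of dimension `≤ 1 + m²Θ`;
* `essSup_stable`, `finrank_essSup_le` — `E = Σ_a ess(nlPart F_a)` is stable under every `mact σ τ` and small;
* `mem_span_one_U` — a small subspace of affine forms stable under all `mact σ τ` lies in `span(1, U)` (`…StableForms.lean` for the
  diagonal action, plus one row transposition);
* `exists_aeval_U` — hence `nlPart F_a = Q_a(U)` for a univariate polynomial `Q_a`, and it is fixed by every `mact σ τ`.

Everything is proved modulo the named fact `depthThree_rankBound`, taken BY NAME as a hypothesis. [cite: KarninShpilka2009, §3;
SaxenaSeshadhri2013, Theorem 5; DixonMortimer1996, Thm 5.2B]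
-/

noncomputable section

open MvPolynomial Equiv Literature.Computability.AlgebraicComplexity

-- `Summit.ValiantsHypothesis.ValiantsHypothesis.…` is the tree's single-conjunct layout (Sub = Summit).
set_option linter.dupNamespace false

namespace Summit.ValiantsHypothesis.ValiantsHypothesis.Theorems

namespace LevelStructure

open RankDistance LinNL LinearSubalgebra ProductAction LevelRep

variable {n : ℕ}

local notation "P2" => MvPolynomial (Fin n × Fin n) ℂ

namespace Setting

variable {D : ℕ} (S : Setting n D)

/-! ### The non-linear part of a cluster sum lies in a small subalgebra -/

/-- The space `Λ_a`: the span of `1` and the gcd-free factors of the cluster of `a` (just `span {1}` for an empty fibre). [folklore] -/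
def Λ (a : Fin S.R.m) : Submodule ℂ (MvPolynomial (Fin n × Fin n) ℂ) :=
  if h : (S.fibre a).Nonempty then Submodule.span ℂ (insert (C 1) (simplePart S.R.L (S.fibre a) h))
  else Submodule.span ℂ {C 1}

/-- `Λ_a` for a nonempty fibre. [folklore] -/
theorem Λ_eq {a : Fin S.R.m} (h : (S.fibre a).Nonempty) :
    S.Λ a = Submodule.span ℂ (insert (C 1) (simplePart S.R.L (S.fibre a) h)) := by
  rw [Λ, dif_pos h]

/-- `C 1 ∈ Λ_a`. [folklore] -/
theorem one_mem_Λ (a : Fin S.R.m) : C 1 ∈ S.Λ a := by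
  by_cases h : (S.fibre a).Nonempty
  · rw [S.Λ_eq h]; exact Submodule.subset_span (Set.mem_insert _ _)
  · rw [Λ, dif_neg h]; exact Submodule.subset_span rfl

/-- `Λ_a ≤ deg1`. [folklore] -/
theorem Λ_le_deg1 (a : Fin S.R.m) : S.Λ a ≤ deg1 ℂ (Fin n × Fin n) := by
  have h1 : (C 1 : MvPolynomial (Fin n × Fin n) ℂ) ∈ deg1 ℂ (Fin n × Fin n) :=
    mem_deg1.2 (by rw [totalDegree_C]; exact Nat.zero_le _)
  by_cases h : (S.fibre a).Nonempty
  · rw [S.Λ_eq h, Submodule.span_le]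
    rintro q (rfl | ⟨i, hi, hq⟩)
    · exact h1
    · exact mem_deg1.2 (S.R.hdeg i q (Multiset.mem_of_le (Multiset.sub_le_self _ _) hq)).le
  · rw [Λ, dif_neg h, Submodule.span_le]
    rintro q rfl; exact h1

/-- `Λ_a` is finite-dimensional, of dimension `≤ 1 + m²Θ`. [folklore] -/
theorem finrank_Λ_le (a : Fin S.R.m) :
    FiniteDimensional ℂ (S.Λ a) ∧ Module.finrank ℂ (S.Λ a) ≤ 1 + S.R.m ^ 2 * S.Θ := by
  have h1fin : FiniteDimensional ℂ (Submodule.span ℂ {(C 1 : MvPolynomial (Fin n × Fin n) ℂ)}) :=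
    FiniteDimensional.span_of_finite ℂ (Set.finite_singleton _)
  have h1 : Module.finrank ℂ (Submodule.span ℂ {(C 1 : MvPolynomial (Fin n × Fin n) ℂ)}) ≤ 1 := by
    have := finrank_span_le_card (R := ℂ) ({(C 1 : MvPolynomial (Fin n × Fin n) ℂ)} : Set (MvPolynomial (Fin n × Fin n) ℂ))
    simpa using this
  by_cases h : (S.fibre a).Nonempty
  · haveI := simplePart_span_finite S.R.L (S.fibre a) h
    rw [S.Λ_eq h, Set.insert_eq, Submodule.span_union]
    refine ⟨inferInstance, (Submodule.finrank_add_le_finrank_add_finrank _ _).trans (Nat.add_le_add h1 ?_)⟩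
    refine (finrank_simplePart_le S.R.L (S.fibre a) h).trans ?_
    calc ∑ i ∈ S.fibre a, ∑ j ∈ S.fibre a, rdist (S.R.L i) (S.R.L j)
        ≤ ∑ i ∈ S.fibre a, ∑ j ∈ S.fibre a, S.Θ := Finset.sum_le_sum fun i hi => Finset.sum_le_sum fun j hj =>
          S.hdiam i j (by rw [(Finset.mem_filter.1 hi).2, (Finset.mem_filter.1 hj).2])
      _ = (S.fibre a).card * ((S.fibre a).card * S.Θ) := by rw [Finset.sum_const, Finset.sum_const, smul_eq_mul, smul_eq_mul]
      _ ≤ S.R.m * (S.R.m * S.Θ) := Nat.mul_le_mul (by simpa using Finset.card_le_univ (S.fibre a))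
          (Nat.mul_le_mul_right _ (by simpa using Finset.card_le_univ (S.fibre a)))
      _ = S.R.m ^ 2 * S.Θ := by ring
  · rw [Λ, dif_neg h]
    exact ⟨h1fin, h1.trans (by omega)⟩

/-- **The non-linear part of a nonzero cluster sum lies in `ℂ[Λ_a]`.** [folklore] -/
theorem nlPart_mem_adjoin_Λ {a : Fin S.R.m} (ha : a ∈ S.labs) :
    nlPart (S.F a) ∈ Algebra.adjoin ℂ (S.Λ a : Set (MvPolynomial (Fin n × Fin n) ℂ)) := by
  classical
  have hne := S.fibre_nonempty ha
  set G := (S.fibre a).inf' hne S.R.L with hG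
  set P : MvPolynomial (Fin n × Fin n) ℂ := ∑ i ∈ S.fibre a, C (S.R.a i) * (S.R.L i - G).prod with hP
  have hGle : ∀ i ∈ S.fibre a, G ≤ S.R.L i := fun i hi => Finset.inf'_le _ hi
  have hFa : S.F a = G.prod * P := by
    rw [F, CleanRep.clusterSum, hP, Finset.mul_sum]
    refine Finset.sum_congr rfl fun i hi => ?_
    rw [CleanRep.T]
    conv_lhs => rw [← add_tsub_cancel_of_le (hGle i hi), Multiset.prod_add]
    ring
  have hGdeg : ∀ q ∈ G, q.totalDegree = 1 := fun q hq => by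
    obtain ⟨i, hi⟩ := hne
    exact S.R.hdeg i q (Multiset.mem_of_le (hGle i hi) hq)
  have hF0 : S.F a ≠ 0 := S.F_ne_zero ha
  have hP0 : P ≠ 0 := by rintro hP0; rw [hFa, hP0, mul_zero] at hF0; exact hF0 rfl
  -- `P ∈ ℂ[Λ_a]`
  have hPmem : P ∈ Algebra.adjoin ℂ (S.Λ a : Set (MvPolynomial (Fin n × Fin n) ℂ)) := by
    rw [hP]
    refine Subalgebra.sum_mem _ fun i hi => Subalgebra.mul_mem _ (Subalgebra.algebraMap_mem _ _)
      (Subalgebra.multiset_prod_mem _ fun q hq => Algebra.subset_adjoin ?_)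
    rw [S.Λ_eq hne]
    exact Submodule.subset_span (Set.mem_insert_of_mem _ ⟨i, hi, hq⟩)
  -- `nlPart (F a) ~ nlPart P ∈ ℂ[Λ_a]`
  have h1 : Associated (nlPart (S.F a)) (nlPart P) := by rw [hFa]; exact nlPart_affine_mul hGdeg hP0
  have h2 : nlPart P ∈ Algebra.adjoin ℂ (S.Λ a : Set (MvPolynomial (Fin n × Fin n) ℂ)) :=
    nlPart_mem_adjoin (S.Λ_le_deg1 a) (S.one_mem_Λ a) hPmem hP0
  obtain ⟨w, hw⟩ := h1.symm
  obtain ⟨u, -, hwu⟩ := MvPolynomial.isUnit_iff_eq_C_of_isReduced.1 w.isUnit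
  rw [← hw, hwu]
  exact Subalgebra.mul_mem _ h2 (Subalgebra.algebraMap_mem _ u)

/-- `Λ_a` is admissible for `nlPart (F a)`, `a ∈ labs`. [folklore] -/
theorem admissible_Λ {a : Fin S.R.m} (ha : a ∈ S.labs) : Admissible (nlPart (S.F a)) (S.Λ a) :=
  ⟨S.Λ_le_deg1 a, S.one_mem_Λ a, S.nlPart_mem_adjoin_Λ ha⟩

/-! ### The sum of the essential spaces is stable and small -/

/-- The sum `E` of the essential spaces of the non-linear parts of the nonzero cluster sums. [folklore] -/
def E : Submodule ℂ (MvPolynomial (Fin n × Fin n) ℂ) := S.labs.sup fun a => ess (nlPart (S.F a))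

/-- `E ≤ deg1`. [folklore] -/
theorem E_le_deg1 : S.E ≤ deg1 ℂ (Fin n × Fin n) :=
  Finset.sup_le fun b _ => (admissible_ess (nlPart (S.F b))).1

/-- **`E` is stable under the matrix action.** [folklore] -/
theorem E_stable (hRB : depthThree_rankBound) (σ τ : Perm (Fin n)) :
    S.E.map (mact σ τ).toLinearEquiv.toLinearMap ≤ S.E := by
  unfold E
  rw [Submodule.map_le_iff_le_comap, Finset.sup_le_iff]
  intro a ha
  rw [← Submodule.map_le_iff_le_comap]
  -- the image of `F a` is some `F a'`, `a' ∈ labs`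
  obtain ⟨a', ha'⟩ := (S.perm_clusterSum hRB σ τ).2 a
  have hFa0 : S.F a ≠ 0 := S.F_ne_zero ha
  have ha'labs : a' ∈ S.labs := S.mem_labs_of_F_ne_zero (by rw [← ha']; exact (map_ne_zero_iff _ (mact σ τ).injective).2 hFa0)
  -- `ess` is equivariant and insensitive to units
  have h1 : ess (mact σ τ (nlPart (S.F a))) = (ess (nlPart (S.F a))).map (mact σ τ).toLinearEquiv.toLinearMap :=
    ess_map (mact σ τ) (fun q hq => by rw [totalDegree_mact]; exact hq)
      (fun q hq => by
        have := totalDegree_mact σ τ ((mact σ τ).symm q)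
        rw [AlgEquiv.apply_symm_apply] at this
        rw [← this]; exact hq) _
  have h2 : Associated (nlPart (S.F a')) (mact σ τ (nlPart (S.F a))) := by
    rw [← ha']; exact nlPart_map (mact σ τ) (totalDegree_mact σ τ) hFa0
  obtain ⟨w, hw⟩ := h2
  obtain ⟨u, hu, hwu⟩ := MvPolynomial.isUnit_iff_eq_C_of_isReduced.1 w.isUnit
  have h3 : ess (mact σ τ (nlPart (S.F a))) = ess (nlPart (S.F a')) := by
    rw [← hw, hwu, mul_comm, ess_C_mul hu.ne_zero]
  rw [← h1, h3]
  exact Finset.le_sup (f := fun a => ess (nlPart (S.F a))) ha'labs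

/-- `E` is finite-dimensional of dimension `≤ m(1 + m²Θ)`. [folklore] -/
theorem finrank_E_le : FiniteDimensional ℂ S.E ∧ Module.finrank ℂ S.E ≤ S.R.m * (1 + S.R.m ^ 2 * S.Θ) := by
  haveI hfin : ∀ a, FiniteDimensional ℂ (ess (nlPart (S.F a))) := fun a =>
    Submodule.finiteDimensional_of_le (admissible_ess _).1
  refine ⟨by unfold E; infer_instance, ?_⟩
  unfold E
  refine (finrank_finset_sup_le S.labs _).trans ?_
  calc ∑ a ∈ S.labs, Module.finrank ℂ (ess (nlPart (S.F a)))
      ≤ ∑ a ∈ S.labs, (1 + S.R.m ^ 2 * S.Θ) := Finset.sum_le_sum fun a ha => by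
        haveI := (S.finrank_Λ_le a).1
        exact (finrank_ess_le (S.admissible_Λ ha)).trans (S.finrank_Λ_le a).2
    _ = S.labs.card * (1 + S.R.m ^ 2 * S.Θ) := by rw [Finset.sum_const, smul_eq_mul]
    _ ≤ S.R.m * (1 + S.R.m ^ 2 * S.Θ) := Nat.mul_le_mul_right _ (Finset.card_image_le.trans (by simp))

end Setting

/-! ### Small stable spaces of affine forms lie in `span(1, U)` -/

/-- The coefficient of `x_P` in `c₀ + a·Σ_diag + b·Σ_offdiag`. [folklore] -/
theorem coeff_diagForm (c₀ a b : ℂ) (P : Fin n × Fin n) :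
    coeff (Finsupp.single P 1) (C c₀ +
      C a * (∑ Q ∈ Finset.univ.filter (fun Q : Fin n × Fin n => Q.1 = Q.2), X Q) +
      C b * (∑ Q ∈ Finset.univ.filter (fun Q : Fin n × Fin n => ¬ Q.1 = Q.2), X Q)) = if P.1 = P.2 then a else b := by
  classical
  simp only [coeff_add, coeff_C, if_neg (Finsupp.single_ne_zero.2 (one_ne_zero)).symm, zero_add, coeff_C_mul, coeff_sum,
    coeff_X]
  have hinj : ∀ Q : Fin n × Fin n, (Finsupp.single Q 1 = Finsupp.single P 1) ↔ Q = P := fun Q =>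
    ⟨fun h => Finsupp.single_left_injective one_ne_zero h, fun h => by rw [h]⟩
  simp only [hinj, Finset.sum_ite_eq', Finset.mem_filter, Finset.mem_univ, true_and]
  by_cases h : P.1 = P.2 <;> simp [h]

/-- **A subspace of affine forms of dimension `d` with `4d + 8 ≤ n`, stable under the whole matrix action, lies in `span(1, U)`.**
(Diagonal stability gives `c₀ + a·Σ_diag + b·Σ_offdiag` by `…StableForms.lean`; one row transposition forces `a = b`.) [folklore] -/
theorem mem_span_one_U {W : Submodule ℂ (MvPolynomial (Fin n × Fin n) ℂ)} [FiniteDimensional ℂ W]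
    (hdeg : W ≤ deg1 ℂ (Fin n × Fin n)) (hstab : ∀ σ τ : Perm (Fin n), W.map (mact σ τ).toLinearEquiv.toLinearMap ≤ W)
    (hdim : 4 * Module.finrank ℂ W + 8 ≤ n) {w : MvPolynomial (Fin n × Fin n) ℂ} (hw : w ∈ W) :
    w ∈ Submodule.span ℂ ({C 1, U n} : Set (MvPolynomial (Fin n × Fin n) ℂ)) := by
  classical
  have hdeg' : ∀ v ∈ W, MvPolynomial.totalDegree v ≤ 1 := fun v hv => mem_deg1.1 (hdeg hv)
  have hstab' : ∀ (σ τ : Perm (Fin n)) (v : MvPolynomial (Fin n × Fin n) ℂ), v ∈ W → mact σ τ v ∈ W :=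
    fun σ τ v hv => hstab σ τ ⟨v, hv, rfl⟩
  have hdiag : ∀ (ρ : Perm (Fin n)) (v : MvPolynomial (Fin n × Fin n) ℂ), v ∈ W → ren ρ v ∈ W :=
    fun ρ v hv => by rw [ren_eq_mact]; exact hstab' ρ ρ v hv
  obtain ⟨c₀, a, b, hwe⟩ := StableForms.exists_eq_of_finrank hdeg' hdiag hdim w hw
  -- three distinct indices
  have hn3 : 3 ≤ n := by omega
  set i : Fin n := ⟨0, by omega⟩
  set j : Fin n := ⟨1, by omega⟩
  set l : Fin n := ⟨2, by omega⟩
  have hij : i ≠ j := by simp [i, j, Fin.ext_iff]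
  have hli : l ≠ i := by simp [i, l, Fin.ext_iff]
  have hlj : l ≠ j := by simp [j, l, Fin.ext_iff]
  -- the row transposition `swap i j` applied to `w`
  set σ : Perm (Fin n) := swap i j
  have hw' : mact σ 1 w ∈ W := hstab' σ 1 w hw
  obtain ⟨c₀', a', b', hwe'⟩ := StableForms.exists_eq_of_finrank hdeg' hdiag hdim _ hw'
  -- coefficients of `w`
  set c : Fin n × Fin n → ℂ := fun P => coeff (Finsupp.single P 1) w with hc
  have hcP : ∀ P : Fin n × Fin n, c P = if P.1 = P.2 then a else b := fun P => by rw [hc]; simp only []; rw [hwe, coeff_diagForm]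
  have hwaff : w = C (coeff 0 w) + ∑ P, C (c P) * X P := HomogTools.eq_C_add_sum_of_totalDegree_le_one (hdeg' w hw)
  -- coefficients of `mact σ 1 w`
  have hre : mact σ 1 w = C (coeff 0 w) + ∑ P, C (c ((Equiv.prodCongr σ (1 : Perm (Fin n))).symm P)) * X P := by
    conv_lhs => rw [hwaff, mact_apply]
    have : (fun p : Fin n × Fin n => (σ p.1, (1 : Perm (Fin n)) p.2)) = ⇑(Equiv.prodCongr σ (1 : Perm (Fin n))) := by
      ext p <;> rfl
    rw [this, rename_affine]
  have hcP' : ∀ P : Fin n × Fin n, c ((Equiv.prodCongr σ (1 : Perm (Fin n))).symm P) = if P.1 = P.2 then a' else b' := by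
    intro P
    have := congrArg (coeff (Finsupp.single P 1)) hwe'
    rw [hre, coeff_single_affine, coeff_diagForm] at this
    exact this
  -- position `(j, i)`: preimage `(i, i)` is diagonal, image is off-diagonal
  have h1 := hcP' (j, i)
  have e1 : (Equiv.prodCongr σ (1 : Perm (Fin n))).symm (j, i) = (i, i) := by
    rw [Equiv.prodCongr_symm, Equiv.prodCongr_apply]
    simp [σ, swap_apply_right]
    rfl
  rw [e1, hcP, if_pos rfl, if_neg hij.symm] at h1
  -- position `(l, i)`: preimage `(l, i)` off-diagonal, image off-diagonal
  have h2 := hcP' (l, i)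
  have e2 : (Equiv.prodCongr σ (1 : Perm (Fin n))).symm (l, i) = (l, i) := by
    rw [Equiv.prodCongr_symm, Equiv.prodCongr_apply]
    simp [σ, swap_apply_of_ne_of_ne hli hlj]
    rfl
  rw [e2, hcP, if_neg hli, if_neg hli] at h2
  -- so `a = b`
  have hab : a = b := by rw [h1, h2]
  rw [hwe, hab, add_assoc, ← mul_add, Finset.sum_filter_add_sum_filter_not]
  refine Submodule.add_mem _ ?_ ?_
  · rw [show C c₀ = c₀ • (C 1 : MvPolynomial (Fin n × Fin n) ℂ) by rw [smul_eq_C_mul, C_1, mul_one]]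
    exact Submodule.smul_mem _ _ (Submodule.subset_span (Set.mem_insert _ _))
  · rw [← smul_eq_C_mul]
    exact Submodule.smul_mem _ _ (Submodule.subset_span (Set.mem_insert_of_mem _ rfl))

namespace Setting

variable {D : ℕ} (S : Setting n D)

/-- **THE NON-LINEAR PARTS ARE POLYNOMIALS IN `U`**: under the dimension condition `4m(1 + m²Θ) + 8 ≤ n`, for every label with
nonzero cluster sum, `nlPart (F a) = Q(U)` for a univariate polynomial `Q`, and it is fixed by the matrix action.
[cite: KarninShpilka2009, §3] -/
theorem exists_aeval_U (hRB : depthThree_rankBound) (hdim : 4 * (S.R.m * (1 + S.R.m ^ 2 * S.Θ)) + 8 ≤ n) {a : Fin S.R.m}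
    (ha : a ∈ S.labs) :
    ∃ Q : Polynomial ℂ, nlPart (S.F a) = Polynomial.aeval (U n) Q ∧ ∀ σ τ : Perm (Fin n), mact σ τ (nlPart (S.F a)) = nlPart (S.F a) := by
  haveI := S.finrank_E_le.1
  have hfr := S.finrank_E_le.2
  have hdimE : 4 * Module.finrank ℂ S.E + 8 ≤ n := by
    have : 4 * Module.finrank ℂ S.E ≤ 4 * (S.R.m * (1 + S.R.m ^ 2 * S.Θ)) := Nat.mul_le_mul_left 4 hfr
    omega
  have hle : ess (nlPart (S.F a)) ≤ S.E := Finset.le_sup (f := fun a => ess (nlPart (S.F a))) ha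
  have hstab := S.E_stable hRB
  have hess : ∀ w ∈ ess (nlPart (S.F a)), w ∈ Submodule.span ℂ ({C 1, U n} : Set (MvPolynomial (Fin n × Fin n) ℂ)) :=
    fun w hw => mem_span_one_U S.E_le_deg1 hstab hdimE (hle hw)
  have h2 : Algebra.adjoin ℂ (ess (nlPart (S.F a)) : Set (MvPolynomial (Fin n × Fin n) ℂ)) ≤ Algebra.adjoin ℂ {U n} := by
    refine Algebra.adjoin_le fun w hw => ?_
    obtain ⟨x, y, hxy⟩ := Submodule.mem_span_pair.1 (hess w hw)
    rw [← hxy, smul_eq_C_mul, smul_eq_C_mul, C_1, mul_one]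
    exact Subalgebra.add_mem _ (Subalgebra.algebraMap_mem _ x)
      (Subalgebra.mul_mem _ (Subalgebra.algebraMap_mem _ y) (Algebra.subset_adjoin (Set.mem_singleton _)))
  have hmem : nlPart (S.F a) ∈ (Polynomial.aeval (U n) : Polynomial ℂ →ₐ[ℂ] _).range := by
    rw [← Algebra.adjoin_singleton_eq_range_aeval]
    exact h2 (mem_adjoin_ess (nlPart (S.F a)))
  obtain ⟨Q, hQ⟩ := hmem
  have hQ' : Polynomial.aeval (U n) Q = nlPart (S.F a) := hQ
  refine ⟨Q, hQ'.symm, fun σ τ => ?_⟩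
  rw [← hQ', ← AlgHom.coe_coe, ← Polynomial.aeval_algHom_apply, AlgHom.coe_coe, mact_U]

end Setting

end LevelStructure

end Summit.ValiantsHypothesis.ValiantsHypothesis.Theorems

end
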